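import Mathlib
import Summits.PneNP.PneNP.Theorems.OverlapGapAlgebraSolvableImpliesStableSectionPeelingWitness

/-!
# PneNP / OverlapGapAlgebra — crux `SolvableImpliesStableSection` (stmt-PneNP-2463):
# the PURE-LITERAL peeling block (2/5) — literal witness paths of surviving clauses

Support for crux `stmt-PneNP-2463` (`Summit.PneNP.PneNP.Theses.OverlapGapAlgebra.SolvableImpliesStableSection`):
the f-free block "bounded-round pure-literal peeling gives stable sections for `k α < 2`" (the literal
refinement of `…PeelingWitness.lean`).  Parallel pure-literal peeling of an instance
`Φ : Fin m → Fin k → Fin n × Bool`: `alive 0 = all clauses`, and a clause stays alive at round `t+1` iff it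
is alive at round `t` and the COMPLEMENT of every one of its literals occurs in another clause alive at
round `t` (otherwise it has a pure literal and is peeled).  Only the forward half of this rule is used
here (hypothesis `hsucc`, any family `alive : ℕ → instances → clauses → Prop`):

* `sissQ_exists_path` — a clause `i` alive at round `R` has a WITNESS PATH `c 0 = i, c 1, …, c R` with
  up-slots `u d` (`u 0 = j₀` prescribed): `c (d+1) ≠ c d` is alive and carries at slot `u (d+1)` the
  complement of the LITERAL of slot `dn (u d)` of `c d` (`dn` any fixed slot map);
* `sissQ_indicator_le` — hence (first repetition, `sissP_path_dichotomy`) the indicator of "`i` alive at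
  round `R`" is at most the number of injective literal witness paths of length `R` from `i` plus the
  number of literal collision patterns, as counted in `…PurePeelingPathCount.lean`.
No definitions; axioms `propext`, `Classical.choice`, `Quot.sound`.
-/

set_option linter.dupNamespace false -- `Summit.PneNP.PneNP.…`: summit = sub-problem (D-0017)

namespace Summit.PneNP.PneNP.Theorems

open Finset
open scoped Classical

section PureWitness

variable {m k n : ℕ}

/-- **Literal witness paths.** If every clause alive at round `t+1` has, for each of its slots, ANOTHER
clause alive at round `t` containing the complement of that slot's literal (`hsucc`), then a clause `i`
alive at round `R` starts a path `c 0 = i, …, c R` (up-slots `u`, `u 0 = j₀`) with `c (d+1) ≠ c d` and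
`lit(c (d+1), u (d+1)) = ¬lit(c d, dn (u d))` for all `d < R`. -/
theorem sissQ_exists_path (alive : ℕ → (Fin m → Fin k → Fin n × Bool) → Fin m → Prop)
    (Φ : Fin m → Fin k → Fin n × Bool)
    (hsucc : ∀ (t : ℕ) (i : Fin m), alive (t + 1) Φ i →
      ∀ j : Fin k, ∃ i' : Fin m, alive t Φ i' ∧ i' ≠ i ∧
        ∃ j' : Fin k, Φ i' j' = ((Φ i j).1, !(Φ i j).2))
    (dn : Fin k → Fin k) :
    ∀ (R : ℕ) (i : Fin m) (j₀ : Fin k), alive R Φ i →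
      ∃ c : ℕ → Fin m, ∃ u : ℕ → Fin k, c 0 = i ∧ u 0 = j₀ ∧
        ∀ d, d < R → Φ (c (d + 1)) (u (d + 1)) = ((Φ (c d) (dn (u d))).1, !(Φ (c d) (dn (u d))).2) ∧
          c (d + 1) ≠ c d := by
  intro R
  induction R with
  | zero =>
    intro i j₀ _
    exact ⟨fun _ => i, fun _ => j₀, rfl, rfl, fun d hd => absurd hd (Nat.not_lt_zero d)⟩
  | succ R ih =>
    intro i j₀ hal
    obtain ⟨i', hi'al, hi'ne, j', hj'⟩ := hsucc R i hal (dn j₀)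
    obtain ⟨c', u', hc'0, hu'0, hc'⟩ := ih i' j' hi'al
    refine ⟨fun d => if d = 0 then i else c' (d - 1), fun d => if d = 0 then j₀ else u' (d - 1),
      if_pos rfl, if_pos rfl, ?_⟩
    intro d hd
    rcases Nat.eq_zero_or_pos d with rfl | hdpos
    · simp only [zero_add, one_ne_zero, if_false, Nat.sub_self, if_true, hc'0, hu'0]
      exact ⟨hj', hi'ne⟩
    · have h1 : d - 1 < R := by omega
      obtain ⟨he, hne⟩ := hc' (d - 1) h1
      have hd1 : d + 1 ≠ 0 := by omega
      have hd0 : d ≠ 0 := by omega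
      have hd2 : d + 1 - 1 = d - 1 + 1 := by omega
      simp only [hd1, hd0, if_false, hd2]
      exact ⟨he, hne⟩

/-- The `ℕ`-extension of finite path data agrees with the path it came from on `[0, R]` (clauses). -/
private theorem sissQ_ext_clause (R : ℕ) (i : Fin m) (c : ℕ → Fin m) (hc0 : c 0 = i) (d : ℕ)
    (hd : d ≤ R) :
    (fun e : ℕ => if h : 0 < e ∧ e ≤ R then (fun x : Fin R => c (x + 1)) ⟨e - 1, Nat.sub_one_lt_of_le h.1 h.2⟩
        else i) d
      = c d := by
  rcases Nat.eq_zero_or_pos d with rfl | hdpos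
  · simp [hc0]
  · have h : 0 < d ∧ d ≤ R := ⟨hdpos, hd⟩
    simp only [h, and_self, dif_pos]
    congr 1
    omega

/-- The `ℕ`-extension of finite path data agrees with the path it came from on `[0, R]` (slots). -/
private theorem sissQ_ext_slot (R : ℕ) (j₀ : Fin k) (u : ℕ → Fin k) (hu0 : u 0 = j₀) (d : ℕ)
    (hd : d ≤ R) :
    (fun e : ℕ => if h : 0 < e ∧ e ≤ R then (fun x : Fin R => u (x + 1)) ⟨e - 1, Nat.sub_one_lt_of_le h.1 h.2⟩
        else j₀) d
      = u d := by
  rcases Nat.eq_zero_or_pos d with rfl | hdpos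
  · simp [hu0]
  · have h : 0 < d ∧ d ≤ R := ⟨hdpos, hd⟩
    simp only [h, and_self, dif_pos]
    congr 1
    omega

/-- Complementation of literals is an involution: `a = ¬b → b = ¬a`. -/
private theorem sissQ_compl_symm {a b : Fin n × Bool} (h : a = (b.1, !b.2)) : b = (a.1, !a.2) := by
  rw [h]
  ext
  · rfl
  · simp

/-- **The indicator bound (literal form).** Under `hsucc`, if clause `i` is alive at round `R` then
`1 ≤ #InjW + ∑_{L < R} #ColW_L`, where `InjW` is the set of injective literal witness-path data
`(c 1..c R, u 1..u R)` of length `R` from `(i, j₀)` realised in `Φ`, and `ColW_L` the set of collision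
data `(c 1..c L, u 1..u L, a, j)` — an injective literal witness path of length `L` from `(i, j₀)` plus
the collision equation `lit(c L, dn (u L)) = ¬lit(c a, j)` (finite data are read through their
`ℕ`-extensions `d ↦ c d` on `[1, L]`, `i` resp. `j₀` elsewhere). -/
theorem sissQ_indicator_le (alive : ℕ → (Fin m → Fin k → Fin n × Bool) → Fin m → Prop)
    (Φ : Fin m → Fin k → Fin n × Bool)
    (hsucc : ∀ (t : ℕ) (i : Fin m), alive (t + 1) Φ i →
      ∀ j : Fin k, ∃ i' : Fin m, alive t Φ i' ∧ i' ≠ i ∧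
        ∃ j' : Fin k, Φ i' j' = ((Φ i j).1, !(Φ i j).2))
    (dn : Fin k → Fin k) (R : ℕ) (i : Fin m) (j₀ : Fin k) (hal : alive R Φ i) :
    1 ≤ ((univ : Finset ((Fin R → Fin m) × (Fin R → Fin k))).filter fun p =>
          (∀ a b, a ≤ R → b ≤ R →
            (fun e : ℕ => if h : 0 < e ∧ e ≤ R then p.1 ⟨e - 1, Nat.sub_one_lt_of_le h.1 h.2⟩ else i) a =
            (fun e : ℕ => if h : 0 < e ∧ e ≤ R then p.1 ⟨e - 1, Nat.sub_one_lt_of_le h.1 h.2⟩ else i) b → a = b) ∧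
          (∀ d, d < R →
            Φ ((fun e : ℕ => if h : 0 < e ∧ e ≤ R then p.1 ⟨e - 1, Nat.sub_one_lt_of_le h.1 h.2⟩ else i) (d + 1))
                ((fun e : ℕ => if h : 0 < e ∧ e ≤ R then p.2 ⟨e - 1, Nat.sub_one_lt_of_le h.1 h.2⟩
                  else j₀) (d + 1)) =
            ((Φ ((fun e : ℕ => if h : 0 < e ∧ e ≤ R then p.1 ⟨e - 1, Nat.sub_one_lt_of_le h.1 h.2⟩ else i) d)
                (dn ((fun e : ℕ => if h : 0 < e ∧ e ≤ R then p.2 ⟨e - 1, Nat.sub_one_lt_of_le h.1 h.2⟩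
                  else j₀) d))).1,
             !(Φ ((fun e : ℕ => if h : 0 < e ∧ e ≤ R then p.1 ⟨e - 1, Nat.sub_one_lt_of_le h.1 h.2⟩ else i) d)
                (dn ((fun e : ℕ => if h : 0 < e ∧ e ≤ R then p.2 ⟨e - 1, Nat.sub_one_lt_of_le h.1 h.2⟩
                  else j₀) d))).2))).card
      + ∑ L ∈ Finset.range R,
        ((univ : Finset ((Fin L → Fin m) × (Fin L → Fin k) × Fin L × Fin k)).filter fun p =>
          (∀ a b, a ≤ L → b ≤ L →
            (fun e : ℕ => if h : 0 < e ∧ e ≤ L then p.1 ⟨e - 1, Nat.sub_one_lt_of_le h.1 h.2⟩ else i) a =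
            (fun e : ℕ => if h : 0 < e ∧ e ≤ L then p.1 ⟨e - 1, Nat.sub_one_lt_of_le h.1 h.2⟩ else i) b → a = b) ∧
          (∀ d, d < L →
            Φ ((fun e : ℕ => if h : 0 < e ∧ e ≤ L then p.1 ⟨e - 1, Nat.sub_one_lt_of_le h.1 h.2⟩ else i) (d + 1))
                ((fun e : ℕ => if h : 0 < e ∧ e ≤ L then p.2.1 ⟨e - 1, Nat.sub_one_lt_of_le h.1 h.2⟩
                  else j₀) (d + 1)) =
            ((Φ ((fun e : ℕ => if h : 0 < e ∧ e ≤ L then p.1 ⟨e - 1, Nat.sub_one_lt_of_le h.1 h.2⟩ else i) d)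
                (dn ((fun e : ℕ => if h : 0 < e ∧ e ≤ L then p.2.1 ⟨e - 1, Nat.sub_one_lt_of_le h.1 h.2⟩
                  else j₀) d))).1,
             !(Φ ((fun e : ℕ => if h : 0 < e ∧ e ≤ L then p.1 ⟨e - 1, Nat.sub_one_lt_of_le h.1 h.2⟩ else i) d)
                (dn ((fun e : ℕ => if h : 0 < e ∧ e ≤ L then p.2.1 ⟨e - 1, Nat.sub_one_lt_of_le h.1 h.2⟩
                  else j₀) d))).2)) ∧
          Φ ((fun e : ℕ => if h : 0 < e ∧ e ≤ L then p.1 ⟨e - 1, Nat.sub_one_lt_of_le h.1 h.2⟩ else i) L)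
              (dn ((fun e : ℕ => if h : 0 < e ∧ e ≤ L then p.2.1 ⟨e - 1, Nat.sub_one_lt_of_le h.1 h.2⟩
                  else j₀) L)) =
            ((Φ ((fun e : ℕ => if h : 0 < e ∧ e ≤ L then p.1 ⟨e - 1, Nat.sub_one_lt_of_le h.1 h.2⟩ else i) p.2.2.1)
                p.2.2.2).1,
             !(Φ ((fun e : ℕ => if h : 0 < e ∧ e ≤ L then p.1 ⟨e - 1, Nat.sub_one_lt_of_le h.1 h.2⟩ else i) p.2.2.1)
                p.2.2.2).2)).card := by
  obtain ⟨c, u, hc0, hu0, hpath⟩ := sissQ_exists_path alive Φ hsucc dn R i j₀ hal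
  rcases sissP_path_dichotomy c R (fun d hd => (hpath d hd).2) with hinj | ⟨L, hLR, hinjL, a, haL, hca⟩
  · -- an injective witness path: the data `(c 1..c R, u 1..u R)` lies in `InjW`
    have hmem : ((fun x : Fin R => c (x + 1), fun x : Fin R => u (x + 1)) :
        (Fin R → Fin m) × (Fin R → Fin k)) ∈
        ((univ : Finset ((Fin R → Fin m) × (Fin R → Fin k))).filter fun p =>
          (∀ a b, a ≤ R → b ≤ R →
            (fun e : ℕ => if h : 0 < e ∧ e ≤ R then p.1 ⟨e - 1, Nat.sub_one_lt_of_le h.1 h.2⟩ else i) a =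
            (fun e : ℕ => if h : 0 < e ∧ e ≤ R then p.1 ⟨e - 1, Nat.sub_one_lt_of_le h.1 h.2⟩ else i) b → a = b) ∧
          (∀ d, d < R →
            Φ ((fun e : ℕ => if h : 0 < e ∧ e ≤ R then p.1 ⟨e - 1, Nat.sub_one_lt_of_le h.1 h.2⟩ else i) (d + 1))
                ((fun e : ℕ => if h : 0 < e ∧ e ≤ R then p.2 ⟨e - 1, Nat.sub_one_lt_of_le h.1 h.2⟩
                  else j₀) (d + 1)) =
            ((Φ ((fun e : ℕ => if h : 0 < e ∧ e ≤ R then p.1 ⟨e - 1, Nat.sub_one_lt_of_le h.1 h.2⟩ else i) d)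
                (dn ((fun e : ℕ => if h : 0 < e ∧ e ≤ R then p.2 ⟨e - 1, Nat.sub_one_lt_of_le h.1 h.2⟩
                  else j₀) d))).1,
             !(Φ ((fun e : ℕ => if h : 0 < e ∧ e ≤ R then p.1 ⟨e - 1, Nat.sub_one_lt_of_le h.1 h.2⟩ else i) d)
                (dn ((fun e : ℕ => if h : 0 < e ∧ e ≤ R then p.2 ⟨e - 1, Nat.sub_one_lt_of_le h.1 h.2⟩
                  else j₀) d))).2))) := by
      rw [Finset.mem_filter]
      refine ⟨mem_univ _, ?_, ?_⟩
      · intro a b ha hb hab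
        rw [sissQ_ext_clause R i c hc0 a ha, sissQ_ext_clause R i c hc0 b hb] at hab
        exact hinj a b ha hb hab
      · intro d hd
        rw [sissQ_ext_clause R i c hc0 (d + 1) (by omega), sissQ_ext_clause R i c hc0 d (by omega),
          sissQ_ext_slot R j₀ u hu0 (d + 1) (by omega), sissQ_ext_slot R j₀ u hu0 d (by omega)]
        exact (hpath d hd).1
    have h1 := Finset.one_le_card.2 ⟨_, hmem⟩
    exact le_trans h1 (Nat.le_add_right _ _)
  · -- a first repetition at `L + 1`: the data `(c 1..c L, u 1..u L, a, u (L+1))` lies in `ColW_L`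
    have hmem : ((fun x : Fin L => c (x + 1), fun x : Fin L => u (x + 1), (⟨a, haL⟩ : Fin L), u (L + 1)) :
        (Fin L → Fin m) × (Fin L → Fin k) × Fin L × Fin k) ∈
        ((univ : Finset ((Fin L → Fin m) × (Fin L → Fin k) × Fin L × Fin k)).filter fun p =>
          (∀ a b, a ≤ L → b ≤ L →
            (fun e : ℕ => if h : 0 < e ∧ e ≤ L then p.1 ⟨e - 1, Nat.sub_one_lt_of_le h.1 h.2⟩ else i) a =
            (fun e : ℕ => if h : 0 < e ∧ e ≤ L then p.1 ⟨e - 1, Nat.sub_one_lt_of_le h.1 h.2⟩ else i) b → a = b) ∧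
          (∀ d, d < L →
            Φ ((fun e : ℕ => if h : 0 < e ∧ e ≤ L then p.1 ⟨e - 1, Nat.sub_one_lt_of_le h.1 h.2⟩ else i) (d + 1))
                ((fun e : ℕ => if h : 0 < e ∧ e ≤ L then p.2.1 ⟨e - 1, Nat.sub_one_lt_of_le h.1 h.2⟩
                  else j₀) (d + 1)) =
            ((Φ ((fun e : ℕ => if h : 0 < e ∧ e ≤ L then p.1 ⟨e - 1, Nat.sub_one_lt_of_le h.1 h.2⟩ else i) d)
                (dn ((fun e : ℕ => if h : 0 < e ∧ e ≤ L then p.2.1 ⟨e - 1, Nat.sub_one_lt_of_le h.1 h.2⟩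
                  else j₀) d))).1,
             !(Φ ((fun e : ℕ => if h : 0 < e ∧ e ≤ L then p.1 ⟨e - 1, Nat.sub_one_lt_of_le h.1 h.2⟩ else i) d)
                (dn ((fun e : ℕ => if h : 0 < e ∧ e ≤ L then p.2.1 ⟨e - 1, Nat.sub_one_lt_of_le h.1 h.2⟩
                  else j₀) d))).2)) ∧
          Φ ((fun e : ℕ => if h : 0 < e ∧ e ≤ L then p.1 ⟨e - 1, Nat.sub_one_lt_of_le h.1 h.2⟩ else i) L)
              (dn ((fun e : ℕ => if h : 0 < e ∧ e ≤ L then p.2.1 ⟨e - 1, Nat.sub_one_lt_of_le h.1 h.2⟩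
                  else j₀) L)) =
            ((Φ ((fun e : ℕ => if h : 0 < e ∧ e ≤ L then p.1 ⟨e - 1, Nat.sub_one_lt_of_le h.1 h.2⟩ else i) p.2.2.1)
                p.2.2.2).1,
             !(Φ ((fun e : ℕ => if h : 0 < e ∧ e ≤ L then p.1 ⟨e - 1, Nat.sub_one_lt_of_le h.1 h.2⟩ else i) p.2.2.1)
                p.2.2.2).2)) := by
      rw [Finset.mem_filter]
      refine ⟨mem_univ _, ?_, ?_, ?_⟩
      · intro x y hx hy hxy
        rw [sissQ_ext_clause L i c hc0 x hx, sissQ_ext_clause L i c hc0 y hy] at hxy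
        exact hinjL x y hx hy hxy
      · intro d hd
        rw [sissQ_ext_clause L i c hc0 (d + 1) (by omega), sissQ_ext_clause L i c hc0 d (by omega),
          sissQ_ext_slot L j₀ u hu0 (d + 1) (by omega), sissQ_ext_slot L j₀ u hu0 d (by omega)]
        exact (hpath d (by omega)).1
      · have hL0 : 0 < L := by omega
        have e1 : (if h : 0 < L ∧ L ≤ L then c (L - 1 + 1) else i) = c L := by
          rw [dif_pos ⟨hL0, le_rfl⟩]; congr 1; omega
        have e2 : (if h : 0 < L ∧ L ≤ L then u (L - 1 + 1) else j₀) = u L := by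
          rw [dif_pos ⟨hL0, le_rfl⟩]; congr 1; omega
        have e3 : (if h : 0 < a ∧ a ≤ L then c (a - 1 + 1) else i) = c a := by
          rcases Nat.eq_zero_or_pos a with rfl | ha0
          · rw [dif_neg (by omega), hc0]
          · rw [dif_pos ⟨ha0, haL.le⟩]; congr 1; omega
        show Φ (if h : 0 < L ∧ L ≤ L then c (L - 1 + 1) else i)
            (dn (if h : 0 < L ∧ L ≤ L then u (L - 1 + 1) else j₀)) =
          ((Φ (if h : 0 < a ∧ a ≤ L then c (a - 1 + 1) else i) (u (L + 1))).1,
           !(Φ (if h : 0 < a ∧ a ≤ L then c (a - 1 + 1) else i) (u (L + 1))).2)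
        rw [e1, e2, e3, ← hca]
        exact sissQ_compl_symm ((hpath L hLR).1)
    have h1 := Finset.one_le_card.2 ⟨_, hmem⟩
    have hLmem : L ∈ Finset.range R := Finset.mem_range.2 hLR
    have h2 := Finset.single_le_sum (s := Finset.range R)
      (f := fun L' => ((univ : Finset ((Fin L' → Fin m) × (Fin L' → Fin k) × Fin L' × Fin k)).filter fun p =>
            (∀ a b, a ≤ L' → b ≤ L' →
              (fun e : ℕ => if h : 0 < e ∧ e ≤ L' then p.1 ⟨e - 1, Nat.sub_one_lt_of_le h.1 h.2⟩ else i) a =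
              (fun e : ℕ => if h : 0 < e ∧ e ≤ L' then p.1 ⟨e - 1, Nat.sub_one_lt_of_le h.1 h.2⟩ else i) b → a = b) ∧
            (∀ d, d < L' →
              Φ ((fun e : ℕ => if h : 0 < e ∧ e ≤ L' then p.1 ⟨e - 1, Nat.sub_one_lt_of_le h.1 h.2⟩ else i) (d + 1))
                  ((fun e : ℕ => if h : 0 < e ∧ e ≤ L' then p.2.1 ⟨e - 1, Nat.sub_one_lt_of_le h.1 h.2⟩
                    else j₀) (d + 1)) =
              ((Φ ((fun e : ℕ => if h : 0 < e ∧ e ≤ L' then p.1 ⟨e - 1, Nat.sub_one_lt_of_le h.1 h.2⟩ else i) d)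
                  (dn ((fun e : ℕ => if h : 0 < e ∧ e ≤ L' then p.2.1 ⟨e - 1, Nat.sub_one_lt_of_le h.1 h.2⟩
                    else j₀) d))).1,
               !(Φ ((fun e : ℕ => if h : 0 < e ∧ e ≤ L' then p.1 ⟨e - 1, Nat.sub_one_lt_of_le h.1 h.2⟩ else i) d)
                  (dn ((fun e : ℕ => if h : 0 < e ∧ e ≤ L' then p.2.1 ⟨e - 1, Nat.sub_one_lt_of_le h.1 h.2⟩
                    else j₀) d))).2)) ∧
            Φ ((fun e : ℕ => if h : 0 < e ∧ e ≤ L' then p.1 ⟨e - 1, Nat.sub_one_lt_of_le h.1 h.2⟩ else i) L')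
                (dn ((fun e : ℕ => if h : 0 < e ∧ e ≤ L' then p.2.1 ⟨e - 1, Nat.sub_one_lt_of_le h.1 h.2⟩
                    else j₀) L')) =
              ((Φ ((fun e : ℕ => if h : 0 < e ∧ e ≤ L' then p.1 ⟨e - 1, Nat.sub_one_lt_of_le h.1 h.2⟩ else i) p.2.2.1)
                  p.2.2.2).1,
               !(Φ ((fun e : ℕ => if h : 0 < e ∧ e ≤ L' then p.1 ⟨e - 1, Nat.sub_one_lt_of_le h.1 h.2⟩
                   else i) p.2.2.1)
                  p.2.2.2).2)).card)
      (fun _ _ => Nat.zero_le _) hLmem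
    exact le_trans (le_trans h1 h2) (Nat.le_add_left _ _)

end PureWitness

end Summit.PneNP.PneNP.Theorems
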